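import Literature.Algebra.Homology.VanishingBaseChangeOfQuasiIso
import Literature.Algebra.Homology.BaseChangeComplex
import Literature.Algebra.Homology.FreeComplexDoubleDualBaseChange
import HarnessLib

/-!
# The two models of `S ⊗_R K•` — Mathlib's `extendScalars f` and the tree's `baseChangeComplex S K•` — have the same cohomology (map-`mkQ` spelling)
# ([MumfordAV1970] §5 Lemma 2; [Weibel1994] §1.1)

Layer `Literature/Algebra/Homology`, namespace `Literature.Algebra.Homology`.  THEOREMS ONLY (no definition, no named fact, no instance, no notation,
no `sorry`), over ★ `VanishingBaseChangeOfQuasiIso` §5 (`extendScalars_d_hom_apply`: the differentials of `(extendScalars f)K•` are `d ⊗ S` on elements),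
★ DEF `BaseChangeComplex` (`baseChangeComplex S K•`, differentials `d ⊗ S` by `rfl`) and ★ `FreeComplexDoubleDualBaseChange` §1 (transport of the map-`mkQ`
cohomology along degreewise isomorphisms).  Cell `hodgecm-mathlib` (D-0151), junction (J10-iii-b) of the «H1-DIM-ANY-CHAR cut» (B-p04 memo v3 §2): the
AFFINE BASE CHANGE of module Čech complexes (★ `GrothendieckComplexOfProper.exists_extendScalars_cechComplex_iso_of_isPullback`) and the flat quasi-iso
base change (★ `quasiIso_extendScalars_map_of_flat`) speak `ModuleCat.extendScalars f`, while the entry point ★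
`finrank_HOne_baseChangeComplex_residueField_eq_finrank_cotangentSpace` and ★ `BaseChangeComplexTowerHOne` speak `baseChangeComplex`; under the algebra
structure `f.toAlgebra` the two complexes have the same terms `S ⊗_R Kⁿ` and the same differentials, so their map-`mkQ` cohomologies are identified
degreewise by the identity.

* **`nonempty_HmkQ_extendScalars_linearEquiv_baseChangeComplex`** — `H^j_mkQ((extendScalars f) K•) ≃ₗ[S] H^j_mkQ(baseChangeComplex S K•)` (free indices
  `i, j, l`); `finrank_HmkQ_extendScalars_eq_baseChangeComplex` — equal `finrank` over `S`.

HC_CM is proved only modulo the 7 printed citations until rung 0 closes; nothing here bears on a summit statement (count-neutral capital).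

## References
* [MumfordAV1970] D. Mumford, *Abelian Varieties* (1970), §5 Lemma 2 (p. 49).
* [Weibel1994] C. A. Weibel, *An introduction to homological algebra* (1994), §1.1 (p. 2).
-/

set_option autoImplicit false

universe u

open CategoryTheory TensorProduct

noncomputable section

namespace Literature.Algebra.Homology

variable {R S : Type u} [CommRing R] [CommRing S] (f : R →+* S) (K : CochainComplex (ModuleCat.{u} R) ℤ)

/-- **`H^j_mkQ((extendScalars f) K•) ≃ₗ[S] H^j_mkQ(baseChangeComplex S K•)`** under `f.toAlgebra`: both complexes have terms `S ⊗_R Kⁿ` and differentials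
`d ⊗ S` (★ `extendScalars_d_hom_apply`, ★ `baseChangeComplex_d_hom`), so the identity in each degree transports the map-`mkQ` cohomology
(★ `nonempty_HOne_linearEquiv_of_comm`). [cite: MumfordAV1970, §5 Lemma 2 (p. 49)] [cite: Weibel1994, §1.1 (p. 2)] -/
theorem nonempty_HmkQ_extendScalars_linearEquiv_baseChangeComplex (i j l : ℤ) :
    letI := f.toAlgebra
    Nonempty (↥((LinearMap.ker ((((ModuleCat.extendScalars f).mapHomologicalComplex (ComplexShape.up ℤ)).obj K).d j l).hom).map
        (LinearMap.range ((((ModuleCat.extendScalars f).mapHomologicalComplex (ComplexShape.up ℤ)).obj K).d i j).hom).mkQ) ≃ₗ[S]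
      ↥((LinearMap.ker ((baseChangeComplex S K).d j l).hom).map (LinearMap.range ((baseChangeComplex S K).d i j).hom).mkQ)) := by
  letI := f.toAlgebra
  refine nonempty_HOne_linearEquiv_of_comm (S := S)
    ((((ModuleCat.extendScalars f).mapHomologicalComplex (ComplexShape.up ℤ)).obj K).d i j).hom
    ((((ModuleCat.extendScalars f).mapHomologicalComplex (ComplexShape.up ℤ)).obj K).d j l).hom
    ((baseChangeComplex S K).d i j).hom ((baseChangeComplex S K).d j l).hom
    (LinearEquiv.refl S (S ⊗[R] K.X i)) (LinearEquiv.refl S (S ⊗[R] K.X j)) (LinearEquiv.refl S (S ⊗[R] K.X l))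
    (fun x => ?_) (fun x => ?_)
  · change ((((ModuleCat.extendScalars f).mapHomologicalComplex (ComplexShape.up ℤ)).obj K).d i j).hom x = (K.d i j).hom.baseChange S x
    exact extendScalars_d_hom_apply f K i j x
  · change ((((ModuleCat.extendScalars f).mapHomologicalComplex (ComplexShape.up ℤ)).obj K).d j l).hom x = (K.d j l).hom.baseChange S x
    exact extendScalars_d_hom_apply f K j l x

/-- **Equal `finrank` of the two models' map-`mkQ` cohomology.** [cite: MumfordAV1970, §5 Lemma 2 (p. 49)] -/
theorem finrank_HmkQ_extendScalars_eq_baseChangeComplex (i j l : ℤ) :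
    letI := f.toAlgebra
    Module.finrank S ↥((LinearMap.ker ((((ModuleCat.extendScalars f).mapHomologicalComplex (ComplexShape.up ℤ)).obj K).d j l).hom).map
        (LinearMap.range ((((ModuleCat.extendScalars f).mapHomologicalComplex (ComplexShape.up ℤ)).obj K).d i j).hom).mkQ) =
      Module.finrank S ↥((LinearMap.ker ((baseChangeComplex S K).d j l).hom).map (LinearMap.range ((baseChangeComplex S K).d i j).hom).mkQ) := by
  letI := f.toAlgebra
  obtain ⟨e⟩ := nonempty_HmkQ_extendScalars_linearEquiv_baseChangeComplex f K i j l
  exact e.finrank_eq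

end Literature.Algebra.Homology

end
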